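import Literature.Probability.RandomPlanarGeometry.LoewnerImageTip
import Literature.Probability.RandomPlanarGeometry.LoewnerTraceFunctional
import HarnessLib

/-!
# The class of the conformal image of a stopped Loewner trace is the stopped class of the image curve

Topic `Probability/RandomPlanarGeometry`; theorems only. Sequel of `LoewnerImageTip.lean`
(Lawler–Schramm–Werner (2003), §5; hull analogue of `MoebiusPole.stopClass_moebius_eq` of
`SLESixMoebiusLocalityProofs.lean`): for a `*`-hull `A`, a driving function `W` (with `W 0 = 0`)
generated by `γ` and alive at the horizon `β`, and a continuous `U'` equal to the image driver
`W̃ ∘ τ` up to `σ β₂` (`β₂ < β`) and generated by `γ̂` (as the continuous path `γc`):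

* `continuous_starMap_stoppedPath` — `s ↦ E_A (γ (T s))` is continuous for `T ≤ β₂`;
* `clockC_toNNReal_imageClockInv` — `σ (τ r)⁺ = r⁺` for `r ∈ [0, σ T]`;
* **`stoppedPathClass_starMap_eq_stopClass`** — the class of `E_A ∘ γ` stopped at `T ≤ β₂`
  equals the class of `γ̂` stopped at the capacity time `σ T` (two monotone traversals
  `s ↦ T s` and `s ↦ τ(σ(T) s)` of the same arc, `Curve.reparamDist_eq_zero_of_monotone'`).

References: [LSW 2003] §5; Lawler (2005), §6.3.
-/

noncomputable section

open Set Filter Topology Function Complex Metric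
open UpperHalfPlane (upperHalfPlaneSet)
open scoped NNReal unitInterval

namespace Literature.Probability.RandomPlanarGeometry

namespace Loewner

variable {W : ℝ≥0 → ℝ} {A : Set ℂ}

section StoppedClass

variable (hW : Continuous W) (hA : IsStarHull A) (hne : A.Nonempty) {β : ℝ≥0}
  (hβ : Disjoint (closedHull W β) A)
include hW hA hne hβ

omit hne in
/-- Along a generating curve, `s ↦ E_A (γ (T s))` is continuous for `T ≤ β` (the curve stays off
`A` in the closed half-plane, where `E_A` is continuous). [folklore] -/
theorem continuous_starMap_stoppedPath {γ : ℝ≥0 → ℂ} (hγ : IsGeneratedByCurve W γ) {T : ℝ≥0}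
    (hT : T ≤ β) : Continuous fun s : I ↦ starMap A (γ (((T : ℝ) * s).toNNReal)) := by
  have hpath : Continuous fun s : I ↦ γ (((T : ℝ) * s).toNNReal) :=
    hγ.continuous.comp (continuous_real_toNNReal.comp (continuous_const.mul continuous_subtype_val))
  refine (continuousOn_starMap hA).comp_continuous hpath fun s ↦ ⟨hγ.im_nonneg _, ?_⟩
  refine hγ.apply_notMem_of_alive hW (alive_mono hT hβ) ?_
  rw [← NNReal.coe_le_coe, Real.coe_toNNReal _ (mul_nonneg T.coe_nonneg s.2.1)]
  exact mul_le_of_le_one_right T.coe_nonneg s.2.2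

omit hne in
/-- `r ↦ E_A (γ r⁺)` is continuous on `[0, T]` for `T ≤ β`. [folklore] -/
theorem continuousOn_starMap_apply_toNNReal {γ : ℝ≥0 → ℂ} (hγ : IsGeneratedByCurve W γ) {T : ℝ≥0}
    (hT : T ≤ β) : ContinuousOn (fun r : ℝ ↦ starMap A (γ r.toNNReal)) (Icc 0 T) := by
  have hpath : Continuous fun r : ℝ ↦ γ r.toNNReal := hγ.continuous.comp continuous_real_toNNReal
  refine (continuousOn_starMap hA).comp hpath.continuousOn fun r hr ↦ ⟨hγ.im_nonneg _, ?_⟩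
  refine hγ.apply_notMem_of_alive hW (alive_mono hT hβ) ?_
  rw [← NNReal.coe_le_coe, Real.coe_toNNReal _ hr.1]
  exact hr.2

/-- `σ (τ r)⁺ = r⁺` for `r ∈ [0, σ β]`. [folklore] -/
theorem clockC_toNNReal_imageClockInv {r : ℝ} (hr : r ∈ Icc (0 : ℝ) (imageClock W A β)) :
    clockC W A (imageClockInv W A β r).toNNReal = r.toNNReal := by
  obtain ⟨hτI, hστ⟩ := imageClockInv_spec hW hA hne hβ hr
  apply NNReal.eq
  have hle : (imageClockInv W A β r).toNNReal ≤ β := by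
    rw [← NNReal.coe_le_coe, Real.coe_toNNReal _ hτI.1]; exact hτI.2
  rw [coe_clockC hW hA hne hβ hle, Real.coe_toNNReal _ hτI.1, hστ, Real.coe_toNNReal _ hr.1]

variable {U' : ℝ≥0 → ℝ} (hU' : Continuous U') {β₂ : ℝ≥0} (hβ₂ : β₂ < β)
  (hagree : ∀ s, s ≤ clockC W A β₂ → U' s = imageDriverC W A β s)
include hU' hβ₂ hagree

/-- **The class of `E_A ∘ γ` stopped at `T ≤ β₂` is the class of the image curve stopped at the
capacity time `σ T`** (two monotone traversals `s ↦ T s` and `s ↦ τ(σ(T) s)` of the same arc).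
[cite: LawlerSchrammWerner2003Restriction, §5] -/
theorem stoppedPathClass_starMap_eq_stopClass (hW0 : W 0 = 0) {γ γ' : ℝ≥0 → ℂ}
    (hγ : IsGeneratedByCurve W γ) (hγ' : IsGeneratedByCurve U' γ') (γc : C(ℝ≥0, ℂ))
    (hγc : ∀ t, γc t = γ' t) {T : ℝ≥0} (hT : T ≤ β₂) :
    stoppedPathClass (starMap A) γ T = stopClass γc (clockC W A T) := by
  have hTβ : T ≤ β := hT.trans hβ₂.le
  have hTI : (T : ℝ) ∈ Icc (0 : ℝ) β := ⟨T.coe_nonneg, NNReal.coe_le_coe.2 hTβ⟩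
  set σT : ℝ := imageClock W A T with hσT
  have hσβ : σT ≤ imageClock W A β :=
    (strictMonoOn_imageClock hW hA hne hβ).monotoneOn hTI ⟨β.coe_nonneg, le_rfl⟩ (NNReal.coe_le_coe.2 hTβ)
  have hσT0 : 0 ≤ σT := (imageClock_mem hW hA hne hβ hTI).1
  have hσTcoe : ((clockC W A T : ℝ≥0) : ℝ) = σT := coe_clockC hW hA hne hβ hTβ
  rw [stoppedPathClass_eq (continuous_starMap_stoppedPath hW hA hβ hγ hTβ), stopClass, CurveClass.mk_eq_mk]
  -- two monotone traversals of `V r = E_A (γ r⁺)` on `[0, T]`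
  set q : ℝ → ℝ := fun r ↦ max 0 (min 1 r) with hq
  have hq01 : ∀ r, q r ∈ Icc (0 : ℝ) 1 := fun r ↦ ⟨le_max_left _ _, max_le zero_le_one (min_le_left _ _)⟩
  set h₁ : ℝ → ℝ := fun r ↦ (T : ℝ) * q r with hh₁
  set h₂ : ℝ → ℝ := fun r ↦ imageClockInv W A β (σT * q r) with hh₂
  have hmemσ : ∀ r, σT * q r ∈ Icc (0 : ℝ) (imageClock W A β) := fun r ↦
    ⟨mul_nonneg hσT0 (hq01 r).1, (mul_le_of_le_one_right hσT0 (hq01 r).2).trans hσβ⟩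
  have hcontInv := continuousOn_imageClockInv hW hA hne hβ
  have hmonoInv := (strictMonoOn_imageClockInv hW hA hne hβ).monotoneOn
  refine Curve.reparamDist_eq_zero_of_monotone' (m := (T : ℝ)) T.coe_nonneg
    (V := fun r ↦ starMap A (γ r.toNNReal)) ?_ (h₁ := h₁) (h₂ := h₂) ?_ ?_ ?_ ?_ ?_ ?_ ?_ ?_ ?_ ?_
  · exact continuousOn_starMap_apply_toNNReal hW hA hβ hγ hTβ
  · exact continuous_const.mul continuous_clampUnit
  · exact hcontInv.comp_continuous (continuous_const.mul continuous_clampUnit) hmemσ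
  · exact fun r r' hrr' ↦ mul_le_mul_of_nonneg_left (monotone_clampUnit hrr') T.coe_nonneg
  · exact fun r r' hrr' ↦ hmonoInv (hmemσ r) (hmemσ r')
      (mul_le_mul_of_nonneg_left (monotone_clampUnit hrr') hσT0)
  · simp [hh₁, hq]
  · simp only [hh₂, hq]
    rw [min_eq_right zero_le_one, max_self, mul_zero]
    exact imageClockInv_zero hW hA hne hβ
  · simp only [hh₁, hq]
    rw [min_self, max_eq_right zero_le_one, mul_one]
  · simp only [hh₂, hq]
    rw [min_self, max_eq_right zero_le_one, mul_one, hσT]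
    exact imageClockInv_imageClock hW hA hne hβ hTI
  · intro t
    show starMap A (γ (((T : ℝ) * t).toNNReal)) = starMap A (γ (h₁ t).toNNReal)
    simp only [hh₁, hq, clampUnit_of_mem t]
  · -- the image curve read at `σT t` is `E_A (γ (τ (σT t)))`
    intro t
    show γc (((clockC W A T : ℝ) * t).toNNReal) = starMap A (γ (h₂ t).toNNReal)
    simp only [hh₂, hq, clampUnit_of_mem t, hσTcoe]
    have hr := hmemσ t
    simp only [hq, clampUnit_of_mem t] at hr
    obtain ⟨hτI, hστ⟩ := imageClockInv_spec hW hA hne hβ hr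
    -- `u = τ(σT t) ≤ T`
    have hle : (imageClockInv W A β (σT * t)).toNNReal ≤ T := by
      rw [← NNReal.coe_le_coe, Real.coe_toNNReal _ hτI.1]
      have h1 : σT * t ∈ Icc (0 : ℝ) (imageClock W A β) := hr
      have h2 : σT ∈ Icc (0 : ℝ) (imageClock W A β) := ⟨hσT0, hσβ⟩
      have := hmonoInv h1 h2 (mul_le_of_le_one_right hσT0 t.2.2)
      rwa [hσT, imageClockInv_imageClock hW hA hne hβ hTI] at this
    rw [← clockC_toNNReal_imageClockInv hW hA hne hβ hr, hγc,
      apply_clockC_eq_of_isGeneratedByCurve hW hA hne hβ hU' hβ₂ hagree hW0 hγ hγ' (hle.trans hT)]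

end StoppedClass

end Loewner

end Literature.Probability.RandomPlanarGeometry

end
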